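import Literature.MathematicalPhysics.KineticTheory.InfiniteChainDynamicsProofs
import Literature.MathematicalPhysics.KineticTheory.NewtonianFlowLocal
import HarnessLib

/-!
# The severed dynamics of the infinite chain (Lanford–Lebowitz–Lieb 1977, (9a)–(9c))

For the chain `P : OscillatorChain` and a finite region `Λ ⊂ ℤ`, LLL's *severed* equations of
motion (9a)–(9c) move the particles of `Λ` under the full force and tie down the particles
outside `Λ` (`OscillatorChain.IsSeveredSolution`, `InfiniteChainDynamics.lean`). This file builds
the severed time evolution `T_t^Λ` from LLL's condition **B1** (global solvability) and **A2**
(`U, V ∈ C²`, which gives uniqueness), and proves what §4 of the paper uses about it: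

* coordinates: an enumeration `e : Fin m ≃ Λ` identifies the fibre `{σ | σ = η off Λ}` with the
  phase space `PhaseSpace m = ℝ^m × ℝ^m` of `NewtonianFlow.lean` (`embed`, `proj`), and the
  severed system with the Newtonian system `q̇ = p`, `ṗ = sevForce η (q)` (boundary positions read
  from `η`), a `C¹` force (so that `NewtonianFlowLocal.lean` — Liouville, measurability, Euler
  scheme for `C¹` forces — applies); `InfiniteChainDynamicsProofs.lean` (proof of LLL Thm 1)
  has the same severed system in the coordinates `Λ → ℝ × ℝ` (`sevGlue Λ σ₀ x = glueWith Λ x σ₀`,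
  `sevField`), which do not fit the `Fin N`-indexed `NewtonianFlow` API; the two are related by
  `embed Λ e η ∘ fibreEquiv e = glueWith Λ · η` (`InfiniteChainSeveredGibbs.lean`);
* `IsSeveredSolution.unique`, `OscillatorChain.severedFlow hB1 Λ` (definition by choice from B1),
  `severedFlow_add` (group law), `severedFlow_eq_embed` (fibre representation through the
  solution family `fibreFlow`, an `NewtonianFlow.IsSolutionFamily`);
* `measurable_severedFlow_uncurry`: `(t, σ) ↦ T_t σ` is measurable (pointwise limit of the
  symplectic Euler iterates, which are continuous in `(t, σ)`;
  `NewtonianFlow.IsSolutionFamily.tendsto_iterate_eulerStep`).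

Liouville's theorem on the fibres and the invariance of Gibbs states (LLL §4 remark (i)) are in
`InfiniteChainSeveredGibbs.lean`. [cite: LanfordLebowitzLieb1977, §2 eqs. (9a)–(9c) and §4]
-/

noncomputable section

open MeasureTheory Filter Topology Set
open scoped ContDiff

namespace Literature.MathematicalPhysics.KineticTheory.HeatConduction

namespace OscillatorChain

variable (P : OscillatorChain)

/-! ### Coordinates on the fibres -/

section Coordinates

variable (Λ : Finset ℤ) {m : ℕ} (e : Fin m ≃ Λ)

/-- Position of site `j`, read from the coordinates `q` inside `Λ` and from `η` outside.
[folklore] -/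
def posAt (η : ChainConfig) (q : Fin m → ℝ) (j : ℤ) : ℝ :=
  if h : j ∈ Λ then q (e.symm ⟨j, h⟩) else (η j).1

/-- The severed force in coordinates: `F_k(q) = -U'(q_k) + V'(q_{e k + 1} - q_k) - V'(q_k - q_{e k - 1})`
with boundary positions read from `η` (LLL (9b) with (1b)–(1c)). [cite: LanfordLebowitzLieb1977, §2 eqs. (9b), (1b)–(1c)] -/
def sevForce (η : ChainConfig) (q : Fin m → ℝ) : Fin m → ℝ := fun k =>
  -deriv P.U (q k) + (deriv P.V (posAt Λ e η q ((e k : ℤ) + 1) - q k) -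
    deriv P.V (q k - posAt Λ e η q ((e k : ℤ) - 1)))

/-- Embedding of the phase space of `Λ` into configurations: coordinates from `z` on `Λ`, `η`
outside. [folklore] -/
def embed (η : ChainConfig) (z : PhaseSpace m) : ChainConfig := fun j =>
  if h : j ∈ Λ then (z.1 (e.symm ⟨j, h⟩), z.2 (e.symm ⟨j, h⟩)) else η j

/-- Projection of a configuration onto the coordinates of `Λ`. [folklore] -/
def proj (σ : ChainConfig) : PhaseSpace m := (fun k => (σ (e k)).1, fun k => (σ (e k)).2)

variable {Λ e}

omit P in
/-- `embed` on `Λ`. [folklore] -/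
theorem embed_apply_of_mem (η : ChainConfig) (z : PhaseSpace m) {j : ℤ} (h : j ∈ Λ) :
    embed Λ e η z j = (z.1 (e.symm ⟨j, h⟩), z.2 (e.symm ⟨j, h⟩)) := by
  simp [embed, h]

omit P in
/-- `embed` at an enumerated site. [folklore] -/
@[simp] theorem embed_apply_coe (η : ChainConfig) (z : PhaseSpace m) (k : Fin m) :
    embed Λ e η z (e k) = (z.1 k, z.2 k) := by
  rw [embed_apply_of_mem η z (e k).2]
  simp

omit P in
/-- `embed` off `Λ`. [folklore] -/
theorem embed_apply_of_not_mem (η : ChainConfig) (z : PhaseSpace m) {j : ℤ} (h : j ∉ Λ) :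
    embed Λ e η z j = η j := by
  simp [embed, h]

omit P in
/-- `proj ∘ embed = id`. [folklore] -/
@[simp] theorem proj_embed (η : ChainConfig) (z : PhaseSpace m) : proj Λ e (embed Λ e η z) = z := by
  ext k <;> simp [proj]

omit P in
/-- `embed η (proj σ) = σ` when `σ = η` off `Λ`. [folklore] -/
theorem embed_proj {σ η : ChainConfig} (h : ∀ j ∉ Λ, σ j = η j) : embed Λ e η (proj Λ e σ) = σ := by
  funext j
  by_cases hj : j ∈ Λ
  · rw [embed_apply_of_mem η _ hj]
    have : (e (e.symm ⟨j, hj⟩) : ℤ) = j := by simp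
    simp only [proj]
    rw [this]
  · rw [embed_apply_of_not_mem η _ hj, h j hj]

omit P in
/-- `embed` only depends on `η` off `Λ`. [folklore] -/
theorem embed_congr {η η' : ChainConfig} (h : ∀ j ∉ Λ, η j = η' j) (z : PhaseSpace m) :
    embed Λ e η z = embed Λ e η' z := by
  funext j
  by_cases hj : j ∈ Λ
  · rw [embed_apply_of_mem η z hj, embed_apply_of_mem η' z hj]
  · rw [embed_apply_of_not_mem η z hj, embed_apply_of_not_mem η' z hj, h j hj]

omit P in
/-- `embed η z = η` off `Λ`. [folklore] -/
theorem embed_eq_off (η : ChainConfig) (z : PhaseSpace m) : ∀ j ∉ Λ, embed Λ e η z j = η j :=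
  fun _ hj => embed_apply_of_not_mem η z hj

omit P in
/-- `posAt` only depends on `η` off `Λ`. [folklore] -/
theorem posAt_congr {η η' : ChainConfig} (h : ∀ j ∉ Λ, η j = η' j) (q : Fin m → ℝ) (j : ℤ) :
    posAt Λ e η q j = posAt Λ e η' q j := by
  unfold posAt
  split_ifs with hj
  · rfl
  · rw [h j hj]

/-- `sevForce` only depends on `η` off `Λ`. [folklore] -/
theorem sevForce_congr {η η' : ChainConfig} (h : ∀ j ∉ Λ, η j = η' j) :
    sevForce P Λ e η = sevForce P Λ e η' := by
  funext q k
  simp only [sevForce, posAt_congr h]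

omit P in
/-- Positions read through `proj`. [folklore] -/
theorem posAt_proj {σ η : ChainConfig} (h : ∀ j ∉ Λ, σ j = η j) (j : ℤ) :
    posAt Λ e η (proj Λ e σ).1 j = (σ j).1 := by
  unfold posAt
  split_ifs with hj
  · have : (e (e.symm ⟨j, hj⟩) : ℤ) = j := by simp
    simp only [proj]
    rw [this]
  · rw [h j hj]

/-- The severed force in coordinates is the chain force. [folklore] -/
theorem sevForce_proj {σ η : ChainConfig} (h : ∀ j ∉ Λ, σ j = η j) (k : Fin m) :
    sevForce P Λ e η (proj Λ e σ).1 k = P.force σ (e k) := by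
  have hk : (proj Λ e σ).1 k = (σ (e k)).1 := rfl
  rw [sevForce, posAt_proj h, posAt_proj h, hk, force_eq]
  ring

omit P in
/-- Each `posAt` is a smooth function of the coordinates. [folklore] -/
theorem contDiff_posAt (η : ChainConfig) (j : ℤ) {n : ℕ∞} :
    ContDiff ℝ n fun q : Fin m → ℝ => posAt Λ e η q j := by
  unfold posAt
  split_ifs with hj
  · exact contDiff_apply ℝ ℝ (e.symm ⟨j, hj⟩)
  · exact contDiff_const

/-- The severed force is `C¹` when `U, V ∈ C²` (LLL condition A2). [folklore] -/
theorem contDiff_sevForce (hU : ContDiff ℝ 2 P.U) (hV : ContDiff ℝ 2 P.V) (η : ChainConfig) :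
    ContDiff ℝ 1 (sevForce P Λ e η) := by
  have hU' := contDiff_one_deriv hU
  have hV' := contDiff_one_deriv hV
  rw [contDiff_pi]
  intro k
  have hqk : ContDiff ℝ 1 fun q : Fin m → ℝ => q k := contDiff_apply ℝ ℝ k
  have hp1 := contDiff_posAt (Λ := Λ) (e := e) η ((e k : ℤ) + 1) (n := 1)
  have hm1 := contDiff_posAt (Λ := Λ) (e := e) η ((e k : ℤ) - 1) (n := 1)
  exact ((hU'.comp hqk).neg).add ((hV'.comp (hp1.sub hqk)).sub (hV'.comp (hqk.sub hm1)))

/-- Joint continuity of the severed force in the configuration (boundary data) and the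
coordinates. [folklore] -/
theorem continuous_sevForce_uncurry (hU : ContDiff ℝ 2 P.U) (hV : ContDiff ℝ 2 P.V) :
    Continuous fun p : ChainConfig × (Fin m → ℝ) => sevForce P Λ e p.1 p.2 := by
  have hU' : Continuous (deriv P.U) := (contDiff_one_deriv hU).continuous
  have hV' : Continuous (deriv P.V) := (contDiff_one_deriv hV).continuous
  have hpos : ∀ j : ℤ, Continuous fun p : ChainConfig × (Fin m → ℝ) => posAt Λ e p.1 p.2 j := by
    intro j
    unfold posAt
    split_ifs with hj
    · exact (continuous_apply _).comp continuous_snd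
    · exact (continuous_apply j).comp continuous_fst |>.fst
  apply continuous_pi
  intro k
  have hqk : Continuous fun p : ChainConfig × (Fin m → ℝ) => p.2 k :=
    (continuous_apply k).comp continuous_snd
  exact ((hU'.comp hqk).neg).add ((hV'.comp ((hpos _).sub hqk)).sub (hV'.comp (hqk.sub (hpos _))))

omit P in
/-- `proj` is continuous. [folklore] -/
theorem continuous_proj : Continuous (proj Λ e : ChainConfig → PhaseSpace m) := by
  apply Continuous.prodMk
  · exact continuous_pi fun k => ((continuous_apply (e k : ℤ)).fst)
  · exact continuous_pi fun k => ((continuous_apply (e k : ℤ)).snd)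

omit P in
/-- `embed` is jointly continuous. [folklore] -/
theorem continuous_embed_uncurry :
    Continuous fun p : ChainConfig × PhaseSpace m => embed Λ e p.1 p.2 := by
  apply continuous_pi
  intro j
  by_cases hj : j ∈ Λ
  · have : (fun p : ChainConfig × PhaseSpace m => embed Λ e p.1 p.2 j) =
        fun p => (p.2.1 (e.symm ⟨j, hj⟩), p.2.2 (e.symm ⟨j, hj⟩)) := by
      funext p; exact embed_apply_of_mem _ _ hj
    rw [this]
    fun_prop
  · have : (fun p : ChainConfig × PhaseSpace m => embed Λ e p.1 p.2 j) = fun p => p.1 j := by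
      funext p; exact embed_apply_of_not_mem _ _ hj
    rw [this]
    fun_prop

omit P in
/-- `embed η` is measurable. [folklore] -/
theorem measurable_embed (η : ChainConfig) : Measurable (embed Λ e η : PhaseSpace m → ChainConfig) :=
  (continuous_embed_uncurry.comp (continuous_const.prodMk continuous_id)).measurable

end Coordinates

/-! ### Severed solutions as integral curves on the fibre -/

section Solutions

variable {P} {Λ : Finset ℤ} {m : ℕ} (e : Fin m ≃ Λ)

/-- Particles outside `Λ` are tied down. [folklore] -/
theorem IsSeveredSolution.apply_of_not_mem {γ : ℝ → ChainConfig} (hγ : P.IsSeveredSolution Λ γ)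
    (t : ℝ) {j : ℤ} (hj : j ∉ Λ) : γ t j = γ 0 j :=
  hγ.2 j hj t

/-- A severed solution, read in coordinates, is an integral curve of the Newtonian field of
`sevForce (γ 0)`. [folklore] -/
theorem IsSeveredSolution.hasDerivAt_proj {γ : ℝ → ChainConfig} (hγ : P.IsSeveredSolution Λ γ)
    (t : ℝ) : HasDerivAt (fun s => proj Λ e (γ s))
      (NewtonianFlow.vectorField (sevForce P Λ e (γ 0)) (proj Λ e (γ t))) t := by
  apply HasDerivAt.prodMk
  · rw [hasDerivAt_pi]
    intro k
    exact (hγ.1 (e k) (e k).2 t).1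
  · rw [hasDerivAt_pi]
    intro k
    have h := (hγ.1 (e k) (e k).2 t).2
    have e1 : P.force (γ t) (e k) = sevForce P Λ e (γ 0) (proj Λ e (γ t)).1 k :=
      (sevForce_proj P (fun j hj => hγ.apply_of_not_mem t hj) k).symm
    rw [e1] at h
    exact h

/-- Conversely, an integral curve on the fibre over `η` embeds to a severed solution. [folklore] -/
theorem isSeveredSolution_embed {η : ChainConfig} {ζ : ℝ → PhaseSpace m}
    (hζ : ∀ t, HasDerivAt ζ (NewtonianFlow.vectorField (sevForce P Λ e η) (ζ t)) t) :
    P.IsSeveredSolution Λ fun t => embed Λ e η (ζ t) := by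
  refine ⟨fun i hi t => ?_, fun i hi t => ?_⟩
  · set k := e.symm ⟨i, hi⟩ with hk
    have hi' : (e k : ℤ) = i := by simp [hk]
    have h1 : HasDerivAt (fun s => (ζ s).1) (ζ t).2 t :=
      ((ContinuousLinearMap.fst ℝ (Fin m → ℝ) (Fin m → ℝ)).hasFDerivAt).comp_hasDerivAt t (hζ t)
    have h2 : HasDerivAt (fun s => (ζ s).2) (sevForce P Λ e η (ζ t).1) t :=
      ((ContinuousLinearMap.snd ℝ (Fin m → ℝ) (Fin m → ℝ)).hasFDerivAt).comp_hasDerivAt t (hζ t)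
    have h1k := (hasDerivAt_pi.1 h1) k
    have h2k := (hasDerivAt_pi.1 h2) k
    have hfun1 : (fun s => (embed Λ e η (ζ s) i).1) = fun s => (ζ s).1 k := by
      funext s; rw [embed_apply_of_mem η _ hi]
    have hfun2 : (fun s => (embed Λ e η (ζ s) i).2) = fun s => (ζ s).2 k := by
      funext s; rw [embed_apply_of_mem η _ hi]
    have hval1 : (embed Λ e η (ζ t) i).2 = (ζ t).2 k := by rw [embed_apply_of_mem η _ hi]
    have hval2 : P.force (embed Λ e η (ζ t)) i = sevForce P Λ e η (ζ t).1 k := by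
      rw [← hi', ← sevForce_proj P (embed_eq_off (Λ := Λ) (e := e) η (ζ t)) k, proj_embed]
    rw [hfun1, hfun2, hval1, hval2]
    exact ⟨h1k, h2k⟩
  · simp [embed_apply_of_not_mem η _ hi]

/-- **Uniqueness of severed solutions** with the same initial configuration (A2: `U, V ∈ C²`).
[folklore] -/
theorem IsSeveredSolution.unique (hU : ContDiff ℝ 2 P.U) (hV : ContDiff ℝ 2 P.V)
    {γ₁ γ₂ : ℝ → ChainConfig} (h₁ : P.IsSeveredSolution Λ γ₁) (h₂ : P.IsSeveredSolution Λ γ₂)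
    (h0 : γ₁ 0 = γ₂ 0) : γ₁ = γ₂ := by
  classical
  set e : Fin (Fintype.card Λ) ≃ Λ := (Fintype.equivFin Λ).symm
  have hF := contDiff_sevForce P (Λ := Λ) (e := e) hU hV (γ₁ 0)
  have hc₁ := h₁.hasDerivAt_proj e
  have hc₂ := h₂.hasDerivAt_proj e
  rw [← h0] at hc₂
  funext t
  have ht : t ∈ Ioo (-(|t| + 1)) (|t| + 1) := by
    constructor <;> cases abs_cases t <;> linarith
  have h00 : (0 : ℝ) ∈ Ioo (-(|t| + 1)) (|t| + 1) := by
    constructor <;> linarith [abs_nonneg t]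
  have key := Literature.Analysis.ODE.eqOn_Ioo_of_hasDerivAt isOpen_univ
    (NewtonianFlow.locallyLipschitzOn_vectorField hF) h00 (fun s _ => hc₁ s)
    (fun _ _ => mem_univ _) (fun s _ => hc₂ s) (by simp [h0]) ht
  have key' : proj Λ e (γ₁ t) = proj Λ e (γ₂ t) := key
  calc γ₁ t = embed Λ e (γ₁ 0) (proj Λ e (γ₁ t)) :=
        (embed_proj fun j hj => h₁.apply_of_not_mem t hj).symm
    _ = embed Λ e (γ₂ 0) (proj Λ e (γ₂ t)) := by rw [key', h0]
    _ = γ₂ t := embed_proj fun j hj => h₂.apply_of_not_mem t hj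

/-- Time shifts of severed solutions are severed solutions. [folklore] -/
theorem IsSeveredSolution.comp_add_const {γ : ℝ → ChainConfig} (hγ : P.IsSeveredSolution Λ γ)
    (s : ℝ) : P.IsSeveredSolution Λ fun t => γ (t + s) := by
  refine ⟨fun i hi t => ?_, fun i hi t => ?_⟩
  · obtain ⟨h1, h2⟩ := hγ.1 i hi (t + s)
    exact ⟨h1.comp_add_const t s, h2.comp_add_const t s⟩
  · simp only [zero_add]
    rw [hγ.2 i hi (t + s), hγ.2 i hi s]

end Solutions

/-! ### The severed flow -/

section Flow

variable {P}

/-- LLL's **severed time evolution** `T_t^Λ` of (9a)–(9c): the global severed solution from `σ`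
provided by condition B1 (a definition by choice; unique under A2 by
`IsSeveredSolution.unique`). [cite: LanfordLebowitzLieb1977, §2 eqs. (9a)–(9c) and §4 condition B1] -/
def severedFlow (hB1 : P.CondB1) (Λ : Finset ℤ) (t : ℝ) (σ : ChainConfig) : ChainConfig :=
  (hB1 Λ σ).choose t

/-- The orbits of the severed flow are severed solutions. [folklore] -/
theorem isSeveredSolution_severedFlow (hB1 : P.CondB1) (Λ : Finset ℤ) (σ : ChainConfig) :
    P.IsSeveredSolution Λ fun t => severedFlow hB1 Λ t σ :=
  (hB1 Λ σ).choose_spec.2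

/-- `T_0 = id`. [folklore] -/
@[simp] theorem severedFlow_zero (hB1 : P.CondB1) (Λ : Finset ℤ) (σ : ChainConfig) :
    severedFlow hB1 Λ 0 σ = σ :=
  (hB1 Λ σ).choose_spec.1

/-- The severed flow ties down the particles outside `Λ`. [folklore] -/
theorem severedFlow_apply_of_not_mem (hB1 : P.CondB1) (Λ : Finset ℤ) (t : ℝ) (σ : ChainConfig)
    {j : ℤ} (hj : j ∉ Λ) :
    severedFlow hB1 Λ t σ j = σ j := by
  have h := (isSeveredSolution_severedFlow hB1 Λ σ).apply_of_not_mem t hj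
  simpa using h

/-- Every severed solution is an orbit of the severed flow (uniqueness). [folklore] -/
theorem IsSeveredSolution.eq_severedFlow {hB1 : P.CondB1} {Λ : Finset ℤ} (hU : ContDiff ℝ 2 P.U)
    (hV : ContDiff ℝ 2 P.V) {γ : ℝ → ChainConfig} (hγ : P.IsSeveredSolution Λ γ) (t : ℝ) :
    γ t = severedFlow hB1 Λ t (γ 0) := by
  have h := hγ.unique hU hV (isSeveredSolution_severedFlow hB1 Λ (γ 0)) (by simp)
  exact congrFun h t

/-- **Group law** of the severed flow: `T_{t+s} = T_t ∘ T_s`. [folklore] -/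
theorem severedFlow_add (hB1 : P.CondB1) (Λ : Finset ℤ) (hU : ContDiff ℝ 2 P.U)
    (hV : ContDiff ℝ 2 P.V) (t s : ℝ) (σ : ChainConfig) :
    severedFlow hB1 Λ (t + s) σ = severedFlow hB1 Λ t (severedFlow hB1 Λ s σ) := by
  have h := ((isSeveredSolution_severedFlow hB1 Λ σ).comp_add_const s).eq_severedFlow
    (hB1 := hB1) hU hV t
  simpa using h

/-- `T_{-t} ∘ T_t = id`. [folklore] -/
theorem severedFlow_neg_apply (hB1 : P.CondB1) (Λ : Finset ℤ) (hU : ContDiff ℝ 2 P.U)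
    (hV : ContDiff ℝ 2 P.V) (t : ℝ) (σ : ChainConfig) :
    severedFlow hB1 Λ (-t) (severedFlow hB1 Λ t σ) = σ := by
  rw [← severedFlow_add hB1 Λ hU hV, neg_add_cancel, severedFlow_zero]

/-- `T_t ∘ T_{-t} = id`. [folklore] -/
theorem severedFlow_apply_neg (hB1 : P.CondB1) (Λ : Finset ℤ) (hU : ContDiff ℝ 2 P.U)
    (hV : ContDiff ℝ 2 P.V) (t : ℝ) (σ : ChainConfig) :
    severedFlow hB1 Λ t (severedFlow hB1 Λ (-t) σ) = σ := by
  rw [← severedFlow_add hB1 Λ hU hV, add_neg_cancel, severedFlow_zero]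

/-- The severed flow on the fibre over `η`, in coordinates: a solution family of the Newtonian
system with force `sevForce η`. [folklore] -/
def fibreFlow (hB1 : P.CondB1) (Λ : Finset ℤ) {m : ℕ} (e : Fin m ≃ Λ) (η : ChainConfig) :
    ℝ → PhaseSpace m → PhaseSpace m :=
  fun t z => proj Λ e (severedFlow hB1 Λ t (embed Λ e η z))

/-- The fibre flow is a solution family (`NewtonianFlow.IsSolutionFamily`). [folklore] -/
theorem isSolutionFamily_fibreFlow (hB1 : P.CondB1) (Λ : Finset ℤ) {m : ℕ} (e : Fin m ≃ Λ)
    (η : ChainConfig) :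
    NewtonianFlow.IsSolutionFamily (sevForce P Λ e η) (fibreFlow hB1 Λ e η) := by
  refine ⟨fun z => by simp [fibreFlow], fun z t => ?_⟩
  have h := (isSeveredSolution_severedFlow hB1 Λ (embed Λ e η z)).hasDerivAt_proj e t
  have hη : sevForce P Λ e (severedFlow hB1 Λ 0 (embed Λ e η z)) = sevForce P Λ e η := by
    rw [severedFlow_zero]
    exact sevForce_congr P (embed_eq_off η z)
  rw [hη] at h
  exact h

/-- **Fibre representation**: `T_t σ = embed η (φ^η_t (proj σ))` whenever `σ = η` off `Λ`.
[folklore] -/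
theorem severedFlow_eq_embed_of_eq_off (hB1 : P.CondB1) (Λ : Finset ℤ) {m : ℕ} (e : Fin m ≃ Λ)
    {σ η : ChainConfig} (h : ∀ j ∉ Λ, σ j = η j) (t : ℝ) :
    severedFlow hB1 Λ t σ = embed Λ e η (fibreFlow hB1 Λ e η t (proj Λ e σ)) := by
  rw [fibreFlow, embed_proj h]
  exact (embed_proj fun j hj => by rw [severedFlow_apply_of_not_mem hB1 Λ t σ hj, h j hj]).symm

/-- `T_t σ = embed σ (φ^σ_t (proj σ))`. [folklore] -/
theorem severedFlow_eq_embed (hB1 : P.CondB1) (Λ : Finset ℤ) {m : ℕ} (e : Fin m ≃ Λ)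
    (σ : ChainConfig) (t : ℝ) :
    severedFlow hB1 Λ t σ = embed Λ e σ (fibreFlow hB1 Λ e σ t (proj Λ e σ)) :=
  severedFlow_eq_embed_of_eq_off hB1 Λ e (fun _ _ => rfl) t

/-- `T_t ∘ embed η = embed η ∘ φ^η_t`. [folklore] -/
theorem severedFlow_embed (hB1 : P.CondB1) (Λ : Finset ℤ) {m : ℕ} (e : Fin m ≃ Λ)
    (η : ChainConfig) (t : ℝ) (z : PhaseSpace m) :
    severedFlow hB1 Λ t (embed Λ e η z) = embed Λ e η (fibreFlow hB1 Λ e η t z) := by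
  rw [severedFlow_eq_embed_of_eq_off hB1 Λ e (embed_eq_off η z), proj_embed]

/-! ### Measurability via the symplectic Euler scheme -/

/-- The `k`-fold symplectic Euler iterate on the fibre, lifted to configurations; jointly
continuous in `(t, σ)`. [folklore] -/
def eulerApprox (Λ : Finset ℤ) {m : ℕ} (e : Fin m ≃ Λ) (k : ℕ) (p : ℝ × ChainConfig) :
    ChainConfig :=
  embed Λ e p.2 ((NewtonianFlow.eulerStep (sevForce P Λ e p.2) (p.1 / (k + 1 : ℕ)))^[k + 1]
    (proj Λ e p.2))

/-- Joint continuity of `(h, σ, z) ↦ S_h^{σ}(z)` and its iterates. [folklore] -/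
theorem continuous_iterate_eulerStep (Λ : Finset ℤ) {m : ℕ} (e : Fin m ≃ Λ) (hU : ContDiff ℝ 2 P.U)
    (hV : ContDiff ℝ 2 P.V) (j : ℕ) :
    Continuous fun p : ℝ × ChainConfig × PhaseSpace m =>
      (NewtonianFlow.eulerStep (sevForce P Λ e p.2.1) p.1)^[j] p.2.2 := by
  have hstep : Continuous fun p : ℝ × ChainConfig × PhaseSpace m =>
      NewtonianFlow.eulerStep (sevForce P Λ e p.2.1) p.1 p.2.2 := by
    have hG := continuous_sevForce_uncurry P (Λ := Λ) (e := e) hU hV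
    simp only [NewtonianFlow.eulerStep_apply]
    apply Continuous.prodMk
    · fun_prop
    · apply Continuous.add
      · fun_prop
      · apply Continuous.smul continuous_fst
        exact hG.comp (by fun_prop : Continuous fun p : ℝ × ChainConfig × PhaseSpace m =>
          (p.2.1, p.2.2.1 + p.1 • p.2.2.2))
  induction j with
  | zero => simp only [Function.iterate_zero, id_eq]; fun_prop
  | succ j ih =>
    have : (fun p : ℝ × ChainConfig × PhaseSpace m =>
        (NewtonianFlow.eulerStep (sevForce P Λ e p.2.1) p.1)^[j + 1] p.2.2) =
        fun p => NewtonianFlow.eulerStep (sevForce P Λ e p.2.1) p.1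
          ((NewtonianFlow.eulerStep (sevForce P Λ e p.2.1) p.1)^[j] p.2.2) := by
      funext p; rw [Function.iterate_succ_apply']
    rw [this]
    exact hstep.comp (continuous_fst.prodMk (continuous_snd.fst.prodMk ih))

/-- The lifted Euler iterates are jointly continuous. [folklore] -/
theorem continuous_eulerApprox (Λ : Finset ℤ) {m : ℕ} (e : Fin m ≃ Λ) (hU : ContDiff ℝ 2 P.U)
    (hV : ContDiff ℝ 2 P.V) (k : ℕ) :
    Continuous (eulerApprox (P := P) Λ e k) := by
  unfold eulerApprox
  refine continuous_embed_uncurry.comp (continuous_snd.prodMk ?_)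
  have h := continuous_iterate_eulerStep (P := P) Λ e hU hV (k + 1)
  exact h.comp ((continuous_fst.div_const _).prodMk (continuous_snd.prodMk
    (continuous_proj.comp continuous_snd)))

/-- The Euler iterates converge to the severed flow, pointwise in `(t, σ)`. [folklore] -/
theorem tendsto_eulerApprox (hB1 : P.CondB1) (Λ : Finset ℤ) {m : ℕ} (e : Fin m ≃ Λ)
    (hU : ContDiff ℝ 2 P.U) (hV : ContDiff ℝ 2 P.V) (p : ℝ × ChainConfig) :
    Tendsto (fun k => eulerApprox (P := P) Λ e k p) atTop (𝓝 (severedFlow hB1 Λ p.1 p.2)) := by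
  have hconv := (isSolutionFamily_fibreFlow hB1 Λ e p.2).tendsto_iterate_eulerStep
    (contDiff_sevForce P hU hV p.2) p.1 (proj Λ e p.2)
  rw [severedFlow_eq_embed hB1 Λ e p.2 p.1]
  have hcont : Continuous fun z : PhaseSpace m => embed Λ e p.2 z :=
    continuous_embed_uncurry.comp (continuous_const.prodMk continuous_id)
  exact (hcont.tendsto _).comp hconv

/-- **Joint measurability of the severed flow** `(t, σ) ↦ T_t σ`. [folklore] -/
theorem measurable_severedFlow_uncurry (hB1 : P.CondB1) (Λ : Finset ℤ) (hU : ContDiff ℝ 2 P.U)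
    (hV : ContDiff ℝ 2 P.V) :
    Measurable fun p : ℝ × ChainConfig => severedFlow hB1 Λ p.1 p.2 := by
  classical
  set e : Fin (Fintype.card Λ) ≃ Λ := (Fintype.equivFin Λ).symm
  rw [measurable_pi_iff]
  intro j
  refine measurable_of_tendsto_metrizable (f := fun k p => eulerApprox (P := P) Λ e k p j)
    (fun k => ((continuous_apply j).comp (continuous_eulerApprox Λ e hU hV k)).measurable) ?_
  rw [tendsto_pi_nhds]
  intro p
  exact ((continuous_apply j).tendsto _).comp (tendsto_eulerApprox hB1 Λ e hU hV p)

/-- Measurability of each severed flow map `T_t`. [folklore] -/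
theorem measurable_severedFlow (hB1 : P.CondB1) (Λ : Finset ℤ) (hU : ContDiff ℝ 2 P.U)
    (hV : ContDiff ℝ 2 P.V) (t : ℝ) :
    Measurable (severedFlow hB1 Λ t) :=
  (measurable_severedFlow_uncurry hB1 Λ hU hV).comp (measurable_const.prodMk measurable_id)

/-- Continuity of the severed orbits `t ↦ T_t σ`. [folklore] -/
theorem continuous_severedFlow_curve (hB1 : P.CondB1) (Λ : Finset ℤ) (σ : ChainConfig) :
    Continuous fun t => severedFlow hB1 Λ t σ := by
  have hγ := isSeveredSolution_severedFlow hB1 Λ σ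
  apply continuous_pi
  intro j
  by_cases hj : j ∈ Λ
  · have h1 : Continuous fun t => (severedFlow hB1 Λ t σ j).1 :=
      continuous_iff_continuousAt.2 fun t => (hγ.1 j hj t).1.continuousAt
    have h2 : Continuous fun t => (severedFlow hB1 Λ t σ j).2 :=
      continuous_iff_continuousAt.2 fun t => (hγ.1 j hj t).2.continuousAt
    exact h1.prodMk h2
  · have : (fun t => severedFlow hB1 Λ t σ j) = fun _ => σ j := by
      funext t; exact severedFlow_apply_of_not_mem hB1 Λ t σ hj
    rw [this]
    exact continuous_const

end Flow

end OscillatorChain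

end Literature.MathematicalPhysics.KineticTheory.HeatConduction

end
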